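import Mathlib
import HarnessLib
import Summits.Ventures.LatticeQCDFlow.Scaling.TorusPlaquetteCoverOrder

/-!
# LatticeQCDFlow / Scaling — top-link structures of plaquette collections in `(ℤ/L)^d`: closed
# collections (the periodic lattice, the boundary of a unit cube) are compatible with NO generation
# order; ranked (peelable) collections are

HONEST FRAMING: exact (Metropolis-corrected) sampling algorithms for lattice gauge theory;
figures of merit are autocorrelation/cost numbers at stated couplings and volumes; no
continuum-physics claim.

Venture `LatticeQCDFlow` (cell pub-lqcd), topic `Scaling`, FANOUT row 30 (lean-1, GEN-23) — OUR WORK on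
THEORY-2.md §4 row C5 (autoregressive context).  `Scaling/AutoregressiveGaugeHeatBathExact2D{,Order}`
(gen-22) proved the SUFFICIENCY half of the context dichotomy on FREE-BOUNDARY two-dimensional blocks:
assigning to every block plaquette an own «top link» (injectively) and generating the links bottom-up,
every top link comes after the three other links of its plaquette, and the one-plaquette heat-bath
conditioners make the autoregressive model EXACT.  Left open there («NOT CLAIMED: the periodic torus
weight»): can the same structure be set up on the full periodic lattice?  NO — and the obstruction is
purely combinatorial, in every dimension `d ≥ 2`: on `(ℤ/L)^d` (`L ≥ 2`) every link lies on
`2(d−1) ≥ 2` plaquettes (`Scaling/TorusPlaquetteCoverOrder.card_filter_mem_plaquetteLinks_eq`), so the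
top link `t(p)` of a plaquette `p` is also a NON-top link of another plaquette `p'` (injectivity), whose
top link must then come later still: `idx t(p) < idx t(p')`.  Iterating, the position of the top link
would increase forever on a finite set.  Hence for EVERY list of links and EVERY injective top-link
assignment some plaquette has a non-top link that does not precede its top link — a one-plaquette
heat-bath autoregression (each conditioner reading the three earlier links of ONE plaquette, each link
serving at most one plaquette) cannot cover all plaquettes of a torus, whatever the order; exactness on
the torus (if any) needs conditioners of another shape.  Free boundaries evade the argument exactly
because boundary links lie on a single plaquette, where the chains `p ↦ p'` stop.

## What is proved (all [ours])

* §1 **`exists_topLink_not_last_of_closed`** — a nonempty collection `S` of plaquettes CLOSED for an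
  injective top-link assignment `t` (the top link of each plaquette of `S` lies on another plaquette of
  `S`) is compatible with NO generation order: some `p ∈ S` has a link `e' ≠ t p` with
  `¬ l.idxOf e' < l.idxOf (t p)`.
* §3 **`exists_cubeFace_topLink_not_last`** — the six faces of a unit cube (`d ≥ 3`) are closed:
  no plaquette complex containing a unit cube — free-boundary boxes in `d ≥ 3` included — carries the
  one-plaquette autoregressive structure.
* §4 **`exists_order_of_topLink_rank`** — conversely, a PEELING RANK (`rank p < rank p'` whenever the top
  link of `p` lies on another plaquette `p'` of the collection) yields a duplicate-free list of all links
  along which every top link comes strictly after the other links of its plaquette — the general form of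
  the bottom-up order of `Scaling/AutoregressiveGaugeHeatBathExact2DOrder`.
* §2 **`exists_plaquette_topLink_not_last`** — `d ≥ 2`, `L ≥ 2`, `t : Plaquette → Edge` injective (that
  `t p` is a link of `p` is not even needed): for every list `l` of links there are a plaquette `p` and a
  link `e' ≠ t p` of `p` with `¬ l.idxOf e' < l.idxOf (t p)`.
* **`not_forall_topLink_last`** — the same as the negation of the bottom-up hypothesis of
  `Scaling/AutoregressiveGaugeHeatBathExact2DOrder` transplanted to the torus.

Pure lattice combinatorics.  No `def`, no `sorry`, nothing cited as a fact.
-/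

namespace Summit.Ventures.LatticeQCDFlow.Theory2.Autoregressive

open Literature.MathematicalPhysics.QuantumFieldTheory

/-! ## §1 Closed plaquette collections admit no compatible top-link structure -/

/-- **Closed collections.**  Let `t` assign a «top link» to the plaquettes of `(ℤ/L)^d`, injectively on a
nonempty finite collection `S` that is CLOSED FOR `t`: the top link of every plaquette of `S` lies on
ANOTHER plaquette of `S` (e.g. every link of every plaquette of `S` lies on another plaquette of `S`, and
`t p` is a link of `p`).  Then for every list `l` of links some plaquette `p ∈ S` has a link `e' ≠ t p`
NOT strictly before `t p` in `l`.  (Otherwise `t p`, a non-top link of the other plaquette `p' ∈ S`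
through it, would precede `t p'`, and `p ↦ l.idxOf (t p)` would increase without end inside `S`.) [ours] -/
theorem exists_topLink_not_last_of_closed {d L : ℕ} [NeZero L] (S : Finset (Plaquette d L))
    (hSne : S.Nonempty) (t : Plaquette d L → Edge d L)
    (hS : ∀ p ∈ S, ∃ p' ∈ S, p' ≠ p ∧ t p ∈ ({(p'.1, p'.2.1.1), (p'.1.shift p'.2.1.1, p'.2.1.2),
        (p'.1.shift p'.2.1.2, p'.2.1.1), (p'.1, p'.2.1.2)} : Finset (Edge d L)))
    (hinj : Set.InjOn t S) (l : List (Edge d L)) :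
    ∃ p ∈ S, ∃ e' ∈ ({(p.1, p.2.1.1), (p.1.shift p.2.1.1, p.2.1.2),
        (p.1.shift p.2.1.2, p.2.1.1), (p.1, p.2.1.2)} : Finset (Edge d L)),
      e' ≠ t p ∧ ¬ l.idxOf e' < l.idxOf (t p) := by
  classical
  by_contra hno
  push Not at hno
  have hsucc : ∀ p ∈ S, ∃ p' ∈ S, l.idxOf (t p) < l.idxOf (t p') := by
    intro p hp
    obtain ⟨p', hp'S, hne, hmem⟩ := hS p hp
    exact ⟨p', hp'S, hno p' hp'S (t p) hmem (fun h => hne (hinj hp'S hp h.symm))⟩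
  obtain ⟨p, hpS, hmax⟩ := Finset.exists_max_image S (fun q => l.idxOf (t q)) hSne
  obtain ⟨p', hp'S, hp'⟩ := hsucc p hpS
  exact absurd (hmax p' hp'S) (not_le.2 hp')

/-! ## §2 The periodic lattice -/

/-- **No injective top-link assignment on a torus is compatible with a generation order.**  `d ≥ 2`,
`L ≥ 2`; `t` assigns injectively a link to every plaquette of `(ℤ/L)^d` (in the intended use `t p` is one
of the four links of `p`, but the argument does not need it).  Then for every list `l` of links some
plaquette `p` has a link `e' ≠ t p` NOT strictly before `t p` in `l` (by `List.idxOf`).  Proof: otherwise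
`p ↦ l.idxOf (t p)` would admit, for every `p`, a plaquette `p' ∋ t p`, `p' ≠ p` (a link lies on
`2(d−1) ≥ 2` plaquettes) with a strictly larger value. [ours] -/
theorem exists_plaquette_topLink_not_last {d L : ℕ} [NeZero L] (hd : 2 ≤ d) (hL : 2 ≤ L)
    (t : Plaquette d L → Edge d L) (hinj : Function.Injective t) (l : List (Edge d L)) :
    ∃ (p : Plaquette d L) (e' : Edge d L), e' ∈ ({(p.1, p.2.1.1), (p.1.shift p.2.1.1, p.2.1.2),
        (p.1.shift p.2.1.2, p.2.1.1), (p.1, p.2.1.2)} : Finset (Edge d L)) ∧ e' ≠ t p ∧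
      ¬ l.idxOf e' < l.idxOf (t p) := by
  classical
  by_contra hno
  push Not at hno
  -- every plaquette has a successor with a strictly later top link
  have hsucc : ∀ p : Plaquette d L, ∃ p' : Plaquette d L, l.idxOf (t p) < l.idxOf (t p') := by
    intro p
    set S := (Finset.univ : Finset (Plaquette d L)).filter (fun q => t p ∈
      ({(q.1, q.2.1.1), (q.1.shift q.2.1.1, q.2.1.2), (q.1.shift q.2.1.2, q.2.1.1), (q.1, q.2.1.2)} :
        Finset (Edge d L))) with hS
    have hcard : 2 ≤ S.card := by
      have h := le_card_filter_mem_plaquetteLinks hd hL (t p)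
      have h2 : 2 ≤ 2 * (d - 1) := by omega
      exact h2.trans h
    -- a plaquette `p' ≠ p` through `t p`
    obtain ⟨p', hp'S, hp'ne⟩ : ∃ p' ∈ S, p' ≠ p := by
      by_contra hnone
      push Not at hnone
      have hsub : S ⊆ {p} := fun q hq => Finset.mem_singleton.2 (hnone q hq)
      have := (Finset.card_le_card hsub).trans_eq (Finset.card_singleton p)
      omega
    rw [hS, Finset.mem_filter] at hp'S
    refine ⟨p', hno p' (t p) hp'S.2 (fun h => hp'ne (hinj h).symm)⟩
  -- impossible on a finite nonempty type: take a plaquette maximising `l.idxOf (t p)`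
  have p₀ : Plaquette d L := (fun _ => 0, ⟨(⟨0, by omega⟩, ⟨1, by omega⟩), by rw [Fin.lt_def]; norm_num⟩)
  obtain ⟨p, -, hmax⟩ := Finset.exists_max_image (Finset.univ : Finset (Plaquette d L))
    (fun q => l.idxOf (t q)) ⟨p₀, Finset.mem_univ _⟩
  obtain ⟨p', hp'⟩ := hsucc p
  exact absurd (hmax p' (Finset.mem_univ _)) (not_le.2 hp')

/-- **The bottom-up hypothesis fails on the torus.**  Negated form: there is no list of links along which
every plaquette's (injectively assigned) top link comes strictly after its three other links. [ours] -/
theorem not_forall_topLink_last {d L : ℕ} [NeZero L] (hd : 2 ≤ d) (hL : 2 ≤ L)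
    (t : Plaquette d L → Edge d L) (hinj : Function.Injective t) (l : List (Edge d L)) :
    ¬ ∀ p : Plaquette d L, ∀ e' ∈ ({(p.1, p.2.1.1), (p.1.shift p.2.1.1, p.2.1.2),
        (p.1.shift p.2.1.2, p.2.1.1), (p.1, p.2.1.2)} : Finset (Edge d L)), e' ≠ t p →
      l.idxOf e' < l.idxOf (t p) := by
  intro h
  obtain ⟨p, e', he', hne, hlt⟩ := exists_plaquette_topLink_not_last hd hL t hinj l
  exact hlt (h p e' he' hne)

/-! ## §3 Dimension `d ≥ 3`: the boundary of a unit cube is closed -/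

/-- **Unit cubes (`d ≥ 3`, any boundary conditions).**  The six faces of the unit cube at `x` in
directions `a < b < c` form a closed collection (each of its twelve links lies on exactly two faces), so
for every top-link assignment `t` (a link of each plaquette, injective) and every list `l` of links one
of the six faces has a link `e' ≠ t p` not strictly before its top link.  Consequently a one-plaquette
heat-bath autoregression of the kind that is exact on free-boundary two-dimensional blocks
(`Scaling/AutoregressiveGaugeHeatBathExact2DOrder`) cannot be set up on ANY plaquette complex containing a
unit cube — free-boundary boxes in `d ≥ 3` included. [ours] -/
theorem exists_cubeFace_topLink_not_last {d L : ℕ} [NeZero L] (x : Site d L)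
    {a b c : Fin d} (hab : a < b) (hbc : b < c)
    (t : Plaquette d L → Edge d L)
    (ht : ∀ p : Plaquette d L, t p ∈ ({(p.1, p.2.1.1), (p.1.shift p.2.1.1, p.2.1.2),
        (p.1.shift p.2.1.2, p.2.1.1), (p.1, p.2.1.2)} : Finset (Edge d L)))
    (hinj : Function.Injective t) (l : List (Edge d L)) :
    ∃ p ∈ ({(x, ⟨(a, b), hab⟩), (x.shift c, ⟨(a, b), hab⟩), (x, ⟨(a, c), hab.trans hbc⟩),
        (x.shift b, ⟨(a, c), hab.trans hbc⟩), (x, ⟨(b, c), hbc⟩), (x.shift a, ⟨(b, c), hbc⟩)} :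
        Finset (Plaquette d L)),
      ∃ e' ∈ ({(p.1, p.2.1.1), (p.1.shift p.2.1.1, p.2.1.2),
        (p.1.shift p.2.1.2, p.2.1.1), (p.1, p.2.1.2)} : Finset (Edge d L)),
      e' ≠ t p ∧ ¬ l.idxOf e' < l.idxOf (t p) := by
  classical
  have hac : a < c := hab.trans hbc
  have nab : a ≠ b := ne_of_lt hab
  have nbc : b ≠ c := ne_of_lt hbc
  -- shifts commute
  have hsc : ∀ (y : Site d L) (i j : Fin d), (y.shift i).shift j = (y.shift j).shift i :=
    fun y i j => by simp only [Site.shift, add_right_comm]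
  refine exists_topLink_not_last_of_closed _ ⟨(x, ⟨(a, b), hab⟩), by simp⟩ t (fun p hp => ?_)
    (hinj.injOn) l
  -- closedness of the six faces: each link of each face lies on another face (applied to `t p`)
  generalize ht p = he
  revert he
  generalize t p = e
  intro he
  simp only [Finset.mem_insert, Finset.mem_singleton] at hp
  -- distinctness of planes
  have pab_ac : (⟨(a, b), hab⟩ : {q : Fin d × Fin d // q.1 < q.2}) ≠ ⟨(a, c), hac⟩ := by
    intro h; exact nbc (congrArg (fun q => q.1.2) h)
  have pab_bc : (⟨(a, b), hab⟩ : {q : Fin d × Fin d // q.1 < q.2}) ≠ ⟨(b, c), hbc⟩ := by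
    intro h; exact nab (congrArg (fun q => q.1.1) h)
  have pac_bc : (⟨(a, c), hac⟩ : {q : Fin d × Fin d // q.1 < q.2}) ≠ ⟨(b, c), hbc⟩ := by
    intro h; exact nab (congrArg (fun q => q.1.1) h)
  rcases hp with rfl | rfl | rfl | rfl | rfl | rfl <;>
    simp only [Finset.mem_insert, Finset.mem_singleton] at he <;>
    rcases he with rfl | rfl | rfl | rfl
  -- F1 = (x; a,b): links (x,a) (x+a,b) (x+b,a) (x,b) → F3, F6, F4, F5
  · exact ⟨(x, ⟨(a, c), hac⟩), by simp, fun h => pab_ac (congrArg Prod.snd h).symm, by simp⟩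
  · exact ⟨(x.shift a, ⟨(b, c), hbc⟩), by simp, fun h => pab_bc (congrArg Prod.snd h).symm, by simp⟩
  · exact ⟨(x.shift b, ⟨(a, c), hac⟩), by simp, fun h => pab_ac (congrArg Prod.snd h).symm, by simp⟩
  · exact ⟨(x, ⟨(b, c), hbc⟩), by simp, fun h => pab_bc (congrArg Prod.snd h).symm, by simp⟩
  -- F2 = (x+c; a,b): links (x+c,a) (x+c+a,b) (x+c+b,a) (x+c,b) → F3, F6, F4, F5
  · exact ⟨(x, ⟨(a, c), hac⟩), by simp, fun h => pab_ac (congrArg Prod.snd h).symm, by simp⟩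
  · exact ⟨(x.shift a, ⟨(b, c), hbc⟩), by simp, fun h => pab_bc (congrArg Prod.snd h).symm,
      by simp [hsc x c a]⟩
  · exact ⟨(x.shift b, ⟨(a, c), hac⟩), by simp, fun h => pab_ac (congrArg Prod.snd h).symm,
      by simp [hsc x c b]⟩
  · exact ⟨(x, ⟨(b, c), hbc⟩), by simp, fun h => pab_bc (congrArg Prod.snd h).symm, by simp⟩
  -- F3 = (x; a,c): links (x,a) (x+a,c) (x+c,a) (x,c) → F1, F6, F2, F5
  · exact ⟨(x, ⟨(a, b), hab⟩), by simp, fun h => pab_ac (congrArg Prod.snd h), by simp⟩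
  · exact ⟨(x.shift a, ⟨(b, c), hbc⟩), by simp, fun h => pac_bc (congrArg Prod.snd h).symm, by simp⟩
  · exact ⟨(x.shift c, ⟨(a, b), hab⟩), by simp, fun h => pab_ac (congrArg Prod.snd h), by simp⟩
  · exact ⟨(x, ⟨(b, c), hbc⟩), by simp, fun h => pac_bc (congrArg Prod.snd h).symm, by simp⟩
  -- F4 = (x+b; a,c): links (x+b,a) (x+b+a,c) (x+b+c,a) (x+b,c) → F1, F6, F2, F5
  · exact ⟨(x, ⟨(a, b), hab⟩), by simp, fun h => pab_ac (congrArg Prod.snd h), by simp⟩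
  · exact ⟨(x.shift a, ⟨(b, c), hbc⟩), by simp, fun h => pac_bc (congrArg Prod.snd h).symm,
      by simp [hsc x b a]⟩
  · exact ⟨(x.shift c, ⟨(a, b), hab⟩), by simp, fun h => pab_ac (congrArg Prod.snd h),
      by simp [hsc x b c]⟩
  · exact ⟨(x, ⟨(b, c), hbc⟩), by simp, fun h => pac_bc (congrArg Prod.snd h).symm, by simp⟩
  -- F5 = (x; b,c): links (x,b) (x+b,c) (x+c,b) (x,c) → F1, F4, F2, F3
  · exact ⟨(x, ⟨(a, b), hab⟩), by simp, fun h => pab_bc (congrArg Prod.snd h), by simp⟩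
  · exact ⟨(x.shift b, ⟨(a, c), hac⟩), by simp, fun h => pac_bc (congrArg Prod.snd h), by simp⟩
  · exact ⟨(x.shift c, ⟨(a, b), hab⟩), by simp, fun h => pab_bc (congrArg Prod.snd h), by simp⟩
  · exact ⟨(x, ⟨(a, c), hac⟩), by simp, fun h => pac_bc (congrArg Prod.snd h), by simp⟩
  -- F6 = (x+a; b,c): links (x+a,b) (x+a+b,c) (x+a+c,b) (x+a,c) → F1, F4, F2, F3
  · exact ⟨(x, ⟨(a, b), hab⟩), by simp, fun h => pab_bc (congrArg Prod.snd h), by simp⟩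
  · exact ⟨(x.shift b, ⟨(a, c), hac⟩), by simp, fun h => pac_bc (congrArg Prod.snd h),
      by simp [hsc x a b]⟩
  · exact ⟨(x.shift c, ⟨(a, b), hab⟩), by simp, fun h => pab_bc (congrArg Prod.snd h),
      by simp [hsc x a c]⟩
  · exact ⟨(x, ⟨(a, c), hac⟩), by simp, fun h => pac_bc (congrArg Prod.snd h), by simp⟩

/-! ## §4 The converse: a ranked (peelable) collection admits a compatible order -/

/-- **Ranked collections admit compatible orders** (general form of the bottom-up order of
`Scaling/AutoregressiveGaugeHeatBathExact2DOrder.exists_bottomUp_order`).  `t` assigns top links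
injectively on a finite collection `B` of plaquettes of `(ℤ/L)^d`, and `rank : Plaquette → ℕ` is a
PEELING RANK: whenever the top link of `p ∈ B` lies on another plaquette `p' ∈ B`, `rank p < rank p'`.
Then listing the non-top links first and the top links by increasing rank gives a duplicate-free list
of ALL links along which, for every `p ∈ B`, every link `e' ≠ t p` of `p` comes strictly before `t p`.
With §1: a compatible order exists iff no sub-collection is closed for `t` (a rank exists iff the
relation «`t p` lies on `p'`» on `B` is acyclic). [ours] -/
theorem exists_order_of_topLink_rank {d L : ℕ} [NeZero L] (B : Finset (Plaquette d L))
    (t : Plaquette d L → Edge d L) (hinj : Set.InjOn t B) (rank : Plaquette d L → ℕ)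
    (hrank : ∀ p ∈ B, ∀ p' ∈ B, p ≠ p' → t p ∈ ({(p'.1, p'.2.1.1), (p'.1.shift p'.2.1.1, p'.2.1.2),
        (p'.1.shift p'.2.1.2, p'.2.1.1), (p'.1, p'.2.1.2)} : Finset (Edge d L)) → rank p < rank p') :
    ∃ l : List (Edge d L), l.Nodup ∧ (∀ e : Edge d L, e ∈ l) ∧
      ∀ p ∈ B, ∀ e' ∈ ({(p.1, p.2.1.1), (p.1.shift p.2.1.1, p.2.1.2),
          (p.1.shift p.2.1.2, p.2.1.1), (p.1, p.2.1.2)} : Finset (Edge d L)),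
        e' ≠ t p → l.idxOf e' < l.idxOf (t p) := by
  classical
  set T : Finset (Edge d L) := B.image t with hT
  set M : ℕ := B.sup rank + 1 with hM
  have hltM : ∀ p ∈ B, rank p < M := fun p hp => Nat.lt_succ_of_le (Finset.le_sup hp)
  -- the block of top links of rank `k`, and the list of all top links by increasing rank
  set blk : ℕ → List (Edge d L) := fun k => ((B.filter (fun p => rank p = k)).image t).toList with hblk
  have hmem_blk : ∀ {k : ℕ} {e : Edge d L}, e ∈ blk k ↔ ∃ p ∈ B, rank p = k ∧ t p = e := by
    intro k e
    simp only [hblk, Finset.mem_toList, Finset.mem_image, Finset.mem_filter]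
    constructor
    · rintro ⟨p, ⟨hp, hk⟩, he⟩; exact ⟨p, hp, hk, he⟩
    · rintro ⟨p, hp, hk, he⟩; exact ⟨p, ⟨hp, hk⟩, he⟩
  have hblk_disj : ∀ {k k' : ℕ} {e : Edge d L}, e ∈ blk k → e ∈ blk k' → k = k' := by
    intro k k' e h h'
    obtain ⟨p, hp, hk, he⟩ := hmem_blk.1 h
    obtain ⟨p', hp', hk', he'⟩ := hmem_blk.1 h'
    have : p = p' := hinj hp hp' (he.trans he'.symm)
    subst this
    exact hk.symm.trans hk'
  set tops : List (Edge d L) := (List.range M).flatMap blk with htops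
  set rest : List (Edge d L) := (Finset.univ \ T).toList with hrest
  have hmem_tops : ∀ {e : Edge d L}, e ∈ tops ↔ e ∈ T := by
    intro e
    simp only [htops, List.mem_flatMap, List.mem_range, hT, Finset.mem_image]
    constructor
    · rintro ⟨k, -, hk⟩
      obtain ⟨p, hp, -, he⟩ := hmem_blk.1 hk
      exact ⟨p, hp, he⟩
    · rintro ⟨p, hp, he⟩
      exact ⟨rank p, hltM p hp, hmem_blk.2 ⟨p, hp, rfl, he⟩⟩
  have hmem_rest : ∀ {e : Edge d L}, e ∈ rest ↔ e ∉ T := by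
    intro e; simp [hrest]
  have hnd_tops : tops.Nodup := by
    rw [htops, List.nodup_flatMap]
    refine ⟨fun k _ => Finset.nodup_toList _, ?_⟩
    refine List.Pairwise.imp_of_mem ?_ List.pairwise_lt_range
    intro k k' _ _ hkk'
    exact List.disjoint_left.2 fun e he he' => absurd (hblk_disj he he') (ne_of_lt hkk')
  refine ⟨rest ++ tops, ?_, ?_, ?_⟩
  · refine List.nodup_append'.2 ⟨Finset.nodup_toList _, hnd_tops, ?_⟩
    exact List.disjoint_left.2 fun e h1 h2 => (hmem_rest.1 h1) (hmem_tops.1 h2)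
  · intro e
    by_cases he : e ∈ T
    · exact List.mem_append_right _ (hmem_tops.2 he)
    · exact List.mem_append_left _ (hmem_rest.2 he)
  · intro p hp e' he' hne
    have htpT : t p ∈ T := by rw [hT, Finset.mem_image]; exact ⟨p, hp, rfl⟩
    have htp_rest : t p ∉ rest := fun h => hmem_rest.1 h htpT
    by_cases he'T : e' ∈ T
    · -- `e' = t p'` with `rank p' < rank p`: it sits in an earlier block
      obtain ⟨p', hp', he'p⟩ : ∃ p' ∈ B, t p' = e' := by
        simpa [hT, Finset.mem_image] using he'T
      have hpp' : p' ≠ p := fun h => hne (by rw [← he'p, h])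
      have hrk : rank p' < rank p := hrank p' hp' p hp hpp' (he'p ▸ he')
      obtain ⟨c, hc⟩ := Nat.exists_eq_add_of_le (hltM p hp).le
      have hsplit : tops = (List.range (rank p)).flatMap blk ++
          ((List.range c).map (rank p + ·)).flatMap blk := by
        rw [htops, hc, List.range_add, List.flatMap_append]
      have he'pre : e' ∈ (List.range (rank p)).flatMap blk :=
        List.mem_flatMap.2 ⟨rank p', List.mem_range.2 hrk, hmem_blk.2 ⟨p', hp', rfl, he'p⟩⟩
      have htp_pre : t p ∉ (List.range (rank p)).flatMap blk := by
        intro h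
        obtain ⟨k, hk, hke⟩ := List.mem_flatMap.1 h
        have : k = rank p := hblk_disj hke (hmem_blk.2 ⟨p, hp, rfl, rfl⟩)
        rw [List.mem_range] at hk
        omega
      have he'_rest : e' ∉ rest := fun h => hmem_rest.1 h he'T
      rw [List.idxOf_append_of_notMem he'_rest, List.idxOf_append_of_notMem htp_rest, hsplit,
        List.idxOf_append_of_mem he'pre, List.idxOf_append_of_notMem htp_pre]
      have := List.idxOf_lt_length_of_mem he'pre
      omega
    · -- `e'` is not a top link: it sits in `rest`
      have h1 : e' ∈ rest := hmem_rest.2 he'T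
      rw [List.idxOf_append_of_mem h1, List.idxOf_append_of_notMem htp_rest]
      exact lt_of_lt_of_le (List.idxOf_lt_length_of_mem h1) (Nat.le_add_right _ _)

end Summit.Ventures.LatticeQCDFlow.Theory2.Autoregressive
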